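import Literature.AnabelianGeometry.EtaleTheta.LogDivisorModelTateTowerKummerTwistCompatR
import Literature.AnabelianGeometry.EtaleTheta.LogDivisorModelTateTowerThetaGalois

/-!
# [EtTh] Def. 3.3 (i)(c)/(ii) v3′: the SHEAR-SEMIDIRECT («Heisenberg-type») ζ-twisted Kummer–Tate group
# `Grp′_{r,σ} := K_r ⋊_{(χ,σ)} (C × ℤ_γ)` — translations act on the Kummer classes by a unipotent integer representation
# `σ`; with `σ :=` the transpose of abc-iut-L2-t3's theta shear ALL `r = 3` classes (roots of `ϖ̈`, `Ü`, `Θ̈`) can act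

S. Mochizuki, *The étale theta function …*, Publ. RIMS **45** (2009) [MochizukiEtTh2009], §1 p.13 (cyclotomic character on
roots), Prop. 1.4 (ii) p.22 (the functional equation `Θ̈(q_X^{a/2}Ü) = (−1)^a q_X^{−a²/2} Ü^{−2a} Θ̈(Ü)` — the shear of the
translations on the functions of `Ÿ`), §3 Def. 3.3 (i)(c) p.72, (ii) p.73 [cite: MochizukiEtTh2009, Def 3.3 (ii) p.73].

CLASS (b) DESIGN MODEL (abc-iut cell, layer L2; TATE TOWER v3 piece 2b(ii) «GRP₃», design FINDING of seat abc-iut-L1-t6 g5,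
STATUS 2026-08-27 ≈01:20Z; sequel of `LogDivisorModelTateTowerKummerTwistGroupR.lean` p479938 — UNTOUCHED, its `KumAdd r` /
`Kum r` / `M` / `Cst` consumed BY NAME).  WHY.  In the DIRECT product `Grp r = (K_r ⋊_χ C) × ℤ_γ` a level action on
abc-iut-L2-t3's `Ÿ`-skeleton must make the Kummer multiplications `f ↦ ζ_m^{κ·e} f` (`e = (c, k, t)` the root exponents of
`ϖ̈_m^c Ü_m^k Θ̈_m^t`, `κ = (κ_ϖ, κ_U, κ_Θ)` the index classes) COMMUTE with the translation shear `e ↦ S_a e`,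
`S_a = [[1, −a, −a²], [0, 1, 2a], [0, 0, 1]]` (`LogDivisorModel.TateTowerTheta.shear`, p477445): `κ·e = κ·S_a e` for all
`e`, `a` forces `κ_ϖ = 0 ∧ 2κ_U = 0` — only the `Θ̈`-class acts freely (on the chain-only skeleton, `t ≡ 0`, this is
abc-iut-L2-d2's «the `ϖ`-root coordinate must act trivially», STATUS 2026-08-26 23:36:04Z).  The relation that DOES hold for
a joint action is `T_a K_κ T_a⁻¹ = K_{κ·S_{−a}}`, i.e. the translation `a` conjugates the index-`n` classes by
`σ_a := (S_{−a})ᵀ : (κ_ϖ, κ_U, κ_Θ) ↦ (κ_ϖ, κ_U + a κ_ϖ, κ_Θ − 2a κ_U − a² κ_ϖ)` — unipotent, integral, LEVEL-INDEPENDENT,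
multiplicative in `a` (the `S_a` commute) and commuting with the scalars of `χ`.  THIS FILE, for a PARAMETER
`σ : Multiplicative ℤ →* Matrix (Fin r) (Fin r) ℤ` (any integer matrix representation of the translations):
* `red r n` — reduction of integer matrices mod `M n`; `act r σ : C × ℤ_γ →* Aut(K_r)`,
  `(c, a) · k = (χ_n(c) · σ̄_a k_n)_n` (`toAdd_act_apply`; jointly continuous, `continuous_act`);
* **`Grp r σ := K_r ⋊_{act} (C × ℤ_γ)`** — topological group ((left, right)-induced topology; instances on this NEW carrier
  only); `ofKum`; the Heisenberg-type relation `conj_transl_ofKum`: `(1,(1,a)) · (k,1) · (1,(1,a))⁻¹ = (σ̄_a k, 1)`, and the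
  ζ-twist `conj_const_delta_coord` as in the parent files;
* Def. 3.3 (i)(c)/(ii) VERBATIM: `closure r σ n = Δ_n := {right = 1, all r classes of index < n trivial}` NORMAL (`σ̄_a` and
  `χ_n` are index-wise linear), nested, pairwise distinct for `r ≠ 0` (`delta`, `le_of_closure_le`), every open
  neighbourhood of `1` contains a `Δ_n`, levels of connected tempered coverings by conjugate stabilisers ⇒
  **`levels r σ : LevelSystem (Grp r σ)`, BOTH laws PROVED**;
* `r = 3`: **`thetaShear : Multiplicative ℤ →* Matrix (Fin 3) (Fin 3) ℤ`**, `thetaShear a = [[1,0,0],[a,1,0],[−a²,−2a,1]]`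
  (a monoid hom — `thetaShear_mul`), the ADEQUACY identity `thetaShear_pairing_shear` (+ the obstruction `pairing_shear_invariant_iff`) tying it to L2-t3's `shear` BY NAME:
  `(σ_a κ) · (eC f, eU f, eT f) = κ · (eC, eU, eT)(shear (−a) f)` for every `f : TateTowerTheta.Exp` — exactly the exponent
  bookkeeping of `T_a K_κ T_a⁻¹ = K_{κ S_{−a}}`; **`Grp₃' := Grp 3 thetaShear`**, `levels₃'`; and the chain case `r = 2`:
  `chainShear a = [[1,0],[a,1]]` (ϖ-roots twistable too), `Grp₂'`.
The compatible part `Ẑ(1)^r ⋊ (Ẑˣ × ℤ_γ)` (σ̄_a is integral, so it preserves compatible families) is the sequel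
`…KummerTwistCompatRShear.lean`.  The σ = 1 case is p479938's `Grp r` up to the evident isomorphism (not restated).
HONEST LABEL: a combinatorial design model for the v2/v3 interfaces, NOT the tempered fundamental group of a Tate curve (whose
geometric part is a genuine Heisenberg group over `Ẑ(1)`; the unipotent `σ` is only its exponent shadow); nothing here bears on
[IUTchIII] Cor. 3.12; no side taken; typed ≠ proved.
-/

noncomputable section

namespace Literature.AnabelianGeometry.EtaleTheta

open CategoryTheory Function Literature.AlgebraicGeometry.Frobenioids
  Literature.AlgebraicGeometry.Frobenioids.QuasiTemperoid Literature.AnabelianGeometry.SemiGraphs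

namespace TateTowerKummerTwistRShear

open TateTowerKummerTwist (M one_lt_M Cst)
open TateTowerKummerTwistR (KumAdd Kum)

variable (r : ℕ) (σ : Multiplicative ℤ →* Matrix (Fin r) (Fin r) ℤ)

/-! ## Integer matrices acting on the index-`n` classes -/

/-- Reduction of integer `r × r` matrices modulo `M n`. [cite: MochizukiEtTh2009, Def 3.3 (ii) p.73] -/
abbrev red (n : ℕ) : Matrix (Fin r) (Fin r) ℤ →+* Matrix (Fin r) (Fin r) (ZMod (M n)) :=
  (Int.castRingHom (ZMod (M n))).mapMatrix

/-- `red` of a product. [cite: MochizukiEtTh2009, Def 3.3 (ii) p.73] -/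
theorem red_mul (n : ℕ) (A B : Matrix (Fin r) (Fin r) ℤ) : red r n (A * B) = red r n A * red r n B := map_mul _ _ _

/-- `σ̄_{a} σ̄_{a'} = σ̄_{a a'}` mod `M n`. [cite: MochizukiEtTh2009, Def 3.3 (ii) p.73] -/
theorem red_sigma_mul (n : ℕ) (a a' : Multiplicative ℤ) :
    red r n (σ a) * red r n (σ a') = red r n (σ (a * a')) := by rw [map_mul σ, red_mul]

/-- `σ̄_1 = 1`. [cite: MochizukiEtTh2009, Def 3.3 (ii) p.73] -/
theorem red_sigma_one (n : ℕ) : red r n (σ 1) = 1 := by rw [map_one, map_one]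

/-! ## The action of `C × ℤ_γ` on the Kummer classes: `χ` (scalars) and `σ` (unipotent shear) -/

/-- The action of `(c, a) ∈ C × ℤ_γ` on the Kummer coordinates: on the `r` classes of index `n`, multiply by `χ_n(c) = c_n` and
apply the reduced matrix `σ̄_a` (additive automorphism; inverse via `σ̄_{a⁻¹}` and `c_n⁻¹`). [cite: MochizukiEtTh2009, §1 p.13] -/
def actAdd (q : Cst × Multiplicative ℤ) : KumAdd r ≃+ KumAdd r where
  toFun k n := (q.1 n : ZMod (M n)) • Matrix.mulVec (red r n (σ q.2)) (k n)
  invFun k n := Matrix.mulVec (red r n (σ q.2⁻¹)) ((((q.1 n)⁻¹ : (ZMod (M n))ˣ) : ZMod (M n)) • k n)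
  left_inv k := funext fun n => by
    dsimp only
    rw [← mul_smul, Units.inv_mul, one_smul, Matrix.mulVec_mulVec, red_sigma_mul, inv_mul_cancel, red_sigma_one,
      Matrix.one_mulVec]
  right_inv k := funext fun n => by
    dsimp only
    rw [Matrix.mulVec_mulVec, red_sigma_mul, mul_inv_cancel, red_sigma_one, Matrix.one_mulVec, ← mul_smul,
      Units.mul_inv, one_smul]
  map_add' k k' := funext fun n => by simp only [Pi.add_apply, Matrix.mulVec_add, smul_add]

/-- `actAdd` on an index. [cite: MochizukiEtTh2009, §1 p.13] -/
@[simp] theorem actAdd_apply (q : Cst × Multiplicative ℤ) (k : KumAdd r) (n : ℕ) :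
    actAdd r σ q k n = (q.1 n : ZMod (M n)) • Matrix.mulVec (red r n (σ q.2)) (k n) := rfl

/-- **The joint action `(χ, σ) : C × ℤ_γ →* Aut(K_r)`** — a homomorphism because the scalars `χ_n(c)` commute with the
matrices `σ̄_a`. [cite: MochizukiEtTh2009, §1 p.13] -/
def act : Cst × Multiplicative ℤ →* MulAut (Kum r) where
  toFun q := AddEquiv.toMultiplicative (actAdd r σ q)
  map_one' := MulEquiv.ext fun k => by
    refine Multiplicative.toAdd.injective (funext fun n => ?_)
    change ((1 : Cst) n : ZMod (M n)) • Matrix.mulVec (red r n (σ (1 : Cst × Multiplicative ℤ).2)) (k.toAdd n) = k.toAdd n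
    rw [Pi.one_apply, Units.val_one, one_smul, Prod.snd_one, red_sigma_one, Matrix.one_mulVec]
  map_mul' q q' := MulEquiv.ext fun k => by
    refine Multiplicative.toAdd.injective (funext fun n => ?_)
    change ((q * q').1 n : ZMod (M n)) • Matrix.mulVec (red r n (σ (q * q').2)) (k.toAdd n) =
      (q.1 n : ZMod (M n)) • Matrix.mulVec (red r n (σ q.2))
        ((q'.1 n : ZMod (M n)) • Matrix.mulVec (red r n (σ q'.2)) (k.toAdd n))
    rw [Matrix.mulVec_smul, Matrix.mulVec_mulVec, red_sigma_mul, ← mul_smul, Prod.fst_mul, Prod.snd_mul, Pi.mul_apply,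
      Units.val_mul]

/-- `act` on an index (additively): `((c,a) · k)_n = χ_n(c) · σ̄_a k_n`. [cite: MochizukiEtTh2009, §1 p.13] -/
@[simp] theorem toAdd_act_apply (q : Cst × Multiplicative ℤ) (k : Kum r) (n : ℕ) :
    (act r σ q k).toAdd n = (q.1 n : ZMod (M n)) • Matrix.mulVec (red r n (σ q.2)) (k.toAdd n) := rfl

/-- A constant-field element `(c, 1)` acts by the scalar `χ_n(c)` alone. [cite: MochizukiEtTh2009, §1 p.13] -/
theorem toAdd_act_const_apply (c : Cst) (k : Kum r) (n : ℕ) :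
    (act r σ (c, 1) k).toAdd n = (c n : ZMod (M n)) • k.toAdd n := by
  show (c n : ZMod (M n)) • Matrix.mulVec (red r n (σ 1)) (k.toAdd n) = _
  rw [red_sigma_one, Matrix.one_mulVec]

/-- A translation `(1, a)` acts by the reduced matrix `σ̄_a` alone. [cite: MochizukiEtTh2009, Prop 1.4 p.22] -/
theorem toAdd_act_transl_apply (a : Multiplicative ℤ) (k : Kum r) (n : ℕ) :
    (act r σ (1, a) k).toAdd n = Matrix.mulVec (red r n (σ a)) (k.toAdd n) := by
  show ((1 : Cst) n : ZMod (M n)) • Matrix.mulVec (red r n (σ a)) (k.toAdd n) = _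
  rw [Pi.one_apply, Units.val_one, one_smul]

/-- **The action is jointly continuous** (the index-`n` output depends on `c_n`, `a` and `k_n` only, through discrete groups).
[cite: MochizukiEtTh2009, §1 p.13] -/
theorem continuous_act : Continuous fun q : (Cst × Multiplicative ℤ) × Kum r => act r σ q.1 q.2 := by
  have h : Continuous fun q : (Cst × Multiplicative ℤ) × Kum r =>
      fun n => (q.1.1 n : ZMod (M n)) • Matrix.mulVec (red r n (σ q.1.2)) (q.2.toAdd n) := by
    refine continuous_pi fun n => ?_
    have h1 : Continuous fun q : (Cst × Multiplicative ℤ) × Kum r => ((q.1.1 n, q.1.2), q.2.toAdd n) :=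
      ((((continuous_apply n).comp (continuous_fst.comp continuous_fst)).prodMk
        (continuous_snd.comp continuous_fst))).prodMk
        ((continuous_apply n).comp (continuous_toAdd.comp continuous_snd))
    exact (continuous_of_discreteTopology
      (f := fun s : ((ZMod (M n))ˣ × Multiplicative ℤ) × (Fin r → ZMod (M n)) =>
        (s.1.1 : ZMod (M n)) • Matrix.mulVec (red r n (σ s.1.2)) s.2)).comp h1
  exact continuous_ofAdd.comp h

/-! ## The group `K_r ⋊_{(χ,σ)} (C × ℤ_γ)` -/

/-- **The shear-semidirect ζ-twisted Kummer–Tate group** `K_r ⋊_{(χ,σ)} (C × ℤ_γ)`: Kummer classes, constant field acting through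
the cyclotomic character, translations acting through `σ`. [cite: MochizukiEtTh2009, Def 3.3 (ii) p.73] -/
abbrev Grp : Type := Kum r ⋊[act r σ] (Cst × Multiplicative ℤ)

/-- The topology of `Grp r σ`: induced along `g ↦ (g.left, g.right)`. [cite: MochizukiEtTh2009, §1 p.12] -/
instance instTopologicalSpaceGrp : TopologicalSpace (Grp r σ) :=
  TopologicalSpace.induced (fun g : Grp r σ => (g.left, g.right)) inferInstance

/-- `g ↦ (g.left, g.right)` is inducing (by definition). [cite: MochizukiEtTh2009, §1 p.12] -/
theorem isInducing_leftRight : Topology.IsInducing fun g : Grp r σ => (g.left, g.right) := ⟨rfl⟩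

/-- **`Grp r σ` is a topological group.** [cite: MochizukiEtTh2009, §1 p.12] -/
instance instIsTopologicalGroupGrp : IsTopologicalGroup (Grp r σ) :=
  SettingModel.Semidirect.isTopologicalGroup_of_continuous_action (isInducing_leftRight r σ) (continuous_act r σ)

/-- The Kummer element with coordinates `k`: `(k, 1)`. [cite: MochizukiEtTh2009, Def 3.3 (ii) p.73] -/
def ofKum (k : Kum r) : Grp r σ := SemidirectProduct.inl k

/-- `ofKum` is continuous. [cite: MochizukiEtTh2009, Def 3.3 (ii) p.73] -/
theorem continuous_ofKum : Continuous (ofKum r σ) := SettingModel.Semidirect.continuous_inl (isInducing_leftRight r σ)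

/-- Conjugation of a Kummer element: `h · (k,1) · h⁻¹ = ((χ,σ)(h_right) · k, 1)`. [cite: MochizukiEtTh2009, §1 p.13] -/
theorem conj_ofKum (h : Grp r σ) (k : Kum r) : h * ofKum r σ k * h⁻¹ = ofKum r σ (act r σ h.right k) := by
  refine SemidirectProduct.ext ?_ ?_
  · rw [ofKum, ofKum, SemidirectProduct.mul_left, SemidirectProduct.mul_left, SemidirectProduct.mul_right,
      SemidirectProduct.left_inl, SemidirectProduct.right_inl, mul_one, SemidirectProduct.inv_left,
      show act r σ h.right (act r σ h.right⁻¹ h.left⁻¹) = h.left⁻¹ by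
        rw [← MulAut.mul_apply, ← map_mul, mul_inv_cancel, map_one, MulAut.one_apply],
      mul_inv_cancel_comm, SemidirectProduct.left_inl]
  · rw [ofKum, ofKum, SemidirectProduct.mul_right, SemidirectProduct.mul_right, SemidirectProduct.right_inl, mul_one,
      SemidirectProduct.inv_right, mul_inv_cancel, SemidirectProduct.right_inl]

/-- **The Heisenberg-type relation**: a translation `a` conjugates the Kummer element `(k,1)` into `(σ̄_a k, 1)` —
`T_a K_κ T_a⁻¹ = K_{σ_a κ}`. [cite: MochizukiEtTh2009, Prop 1.4 p.22] -/
theorem conj_transl_ofKum (a : Multiplicative ℤ) (k : Kum r) (n : ℕ) :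
    ((SemidirectProduct.inr ((1 : Cst), a) : Grp r σ) * ofKum r σ k * (SemidirectProduct.inr ((1 : Cst), a))⁻¹).left.toAdd n =
      Matrix.mulVec (red r n (σ a)) (k.toAdd n) := by
  rw [conj_ofKum, ofKum, SemidirectProduct.left_inl, SemidirectProduct.right_inr, toAdd_act_transl_apply]

/-! ## The level subgroups `Δ_n` -/

/-- **`Δ_n = Δ^{fil,∞}_n`**: trivial `C × ℤ_γ` component and ALL `r` Kummer classes trivial at the indices `< n`.
[cite: MochizukiEtTh2009, Def 3.3 (i) p.72] -/
def closure (n : ℕ) : Subgroup (Grp r σ) where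
  carrier := {g | g.right = 1 ∧ ∀ i < n, g.left.toAdd i = 0}
  mul_mem' := by
    rintro a b ⟨ha, ha'⟩ ⟨hb, hb'⟩
    refine ⟨by rw [SemidirectProduct.mul_right, ha, hb, mul_one], fun i hi => ?_⟩
    rw [SemidirectProduct.mul_left, ha, map_one, MulAut.one_apply, toAdd_mul, Pi.add_apply, ha' i hi, hb' i hi, add_zero]
  one_mem' := ⟨rfl, fun _ _ => rfl⟩
  inv_mem' := by
    rintro a ⟨ha, ha'⟩
    refine ⟨by rw [SemidirectProduct.inv_right, ha, inv_one], fun i hi => ?_⟩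
    rw [SemidirectProduct.inv_left, ha, inv_one, map_one, MulAut.one_apply, toAdd_inv, Pi.neg_apply, ha' i hi, neg_zero]

/-- Membership in `Δ_n`. [cite: MochizukiEtTh2009, Def 3.3 (i) p.72] -/
theorem mem_closure_iff (n : ℕ) (g : Grp r σ) : g ∈ closure r σ n ↔ g.right = 1 ∧ ∀ i < n, g.left.toAdd i = 0 := Iff.rfl

/-- An element of `Δ_n` is the Kummer element of its Kummer coordinates. [cite: MochizukiEtTh2009, Def 3.3 (i) p.72] -/
theorem eq_ofKum_of_mem_closure {n : ℕ} {g : Grp r σ} (hg : g ∈ closure r σ n) : g = ofKum r σ g.left :=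
  SemidirectProduct.ext (by rw [ofKum, SemidirectProduct.left_inl]) (by rw [ofKum, SemidirectProduct.right_inl, hg.1])

/-- `(k,1) ∈ Δ_n` iff the coordinates of `k` at the indices `< n` vanish. [cite: MochizukiEtTh2009, Def 3.3 (i) p.72] -/
theorem ofKum_mem_closure_iff (n : ℕ) (k : Kum r) : ofKum r σ k ∈ closure r σ n ↔ ∀ i < n, k.toAdd i = 0 := by
  rw [mem_closure_iff]
  simp only [ofKum, SemidirectProduct.right_inl, SemidirectProduct.left_inl, true_and]

/-- **`Δ_n` is NORMAL** (`χ_n` and `σ̄_a` act index-wise and linearly, so they preserve «index-`i` classes vanish»).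
[cite: MochizukiEtTh2009, Def 3.3 (i) p.72] -/
theorem closure_normal (n : ℕ) : (closure r σ n).Normal := by
  refine ⟨fun g hg h => ?_⟩
  have hk := (ofKum_mem_closure_iff r σ n g.left).1 (eq_ofKum_of_mem_closure r σ hg ▸ hg)
  rw [eq_ofKum_of_mem_closure r σ hg, conj_ofKum, ofKum_mem_closure_iff]
  intro i hi
  rw [toAdd_act_apply, hk i hi, Matrix.mulVec_zero, smul_zero]

/-- The `Δ_n` are nested. [cite: MochizukiEtTh2009, Def 3.3 (i) p.72] -/
theorem closure_antitone {n m : ℕ} (h : n ≤ m) : closure r σ m ≤ closure r σ n :=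
  fun _ hg => ⟨hg.1, fun i hi => hg.2 i (lt_of_lt_of_le hi h)⟩

/-- The Kummer generator of index `i` and class `j`. [cite: MochizukiEtTh2009, Def 3.3 (ii) p.73] -/
def delta (i : ℕ) (j : Fin r) : Grp r σ := ofKum r σ (Multiplicative.ofAdd (Pi.single i (Pi.single j (1 : ZMod (M i)))))

/-- `δ_{i,j} ∈ Δ_n` iff `n ≤ i`. [cite: MochizukiEtTh2009, Def 3.3 (i) p.72] -/
theorem delta_mem_closure_iff (i : ℕ) (j : Fin r) (n : ℕ) : delta r σ i j ∈ closure r σ n ↔ n ≤ i := by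
  rw [delta, ofKum_mem_closure_iff]
  constructor
  · intro h
    by_contra hlt
    have h1 := congrArg (fun f => f j) (h i (lt_of_not_ge hlt))
    simp only [toAdd_ofAdd, Pi.single_eq_same, Pi.zero_apply] at h1
    haveI : Fact (1 < M i) := ⟨one_lt_M i⟩
    exact one_ne_zero h1
  · intro h i' hi'
    rw [toAdd_ofAdd, Pi.single_eq_of_ne (Nat.ne_of_lt (lt_of_lt_of_le hi' h))]

/-- `Δ_j ⊆ Δ_i` forces `i ≤ j` (`r ≠ 0`): the level subgroups are pairwise distinct. [cite: MochizukiEtTh2009, Def 3.3 (i) p.72] -/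
theorem le_of_closure_le [NeZero r] {i j : ℕ} (h : closure r σ j ≤ closure r σ i) : i ≤ j :=
  (delta_mem_closure_iff r σ j 0 i).1 (h ((delta_mem_closure_iff r σ j 0 j).2 le_rfl))

/-- **Every open neighbourhood of `1` contains some `Δ_n`** (product topology of finite discrete groups on `K_r`).
[cite: MochizukiEtTh2009, Def 3.3 (i) p.72] -/
theorem exists_closure_subset_of_isOpen {U : Set (Grp r σ)} (hU : IsOpen U) (h1 : (1 : Grp r σ) ∈ U) :
    ∃ n, (closure r σ n : Set (Grp r σ)) ⊆ U := by
  let ι : KumAdd r → Grp r σ := fun k => ofKum r σ (Multiplicative.ofAdd k)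
  have hι : Continuous ι := (continuous_ofKum r σ).comp continuous_ofAdd
  have h0 : (0 : KumAdd r) ∈ ι ⁻¹' U := by
    change ofKum r σ (Multiplicative.ofAdd 0) ∈ U
    rw [ofAdd_zero, ofKum, map_one]
    exact h1
  obtain ⟨I, w, hw, hIw⟩ := isOpen_pi_iff.1 (hU.preimage hι) 0 h0
  refine ⟨I.sup id + 1, fun g hg => ?_⟩
  have hk := (ofKum_mem_closure_iff r σ _ g.left).1 (eq_ofKum_of_mem_closure r σ hg ▸ hg)
  have hmem : g.left.toAdd ∈ (I : Set ℕ).pi w := by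
    intro a ha
    have hlt : a < I.sup id + 1 := Nat.lt_succ_of_le (Finset.le_sup (f := id) ha)
    rw [hk a hlt]
    exact (hw a ha).2
  have hU' := hIw hmem
  change ofKum r σ (Multiplicative.ofAdd g.left.toAdd) ∈ U at hU'
  rw [ofAdd_toAdd, ← eq_ofKum_of_mem_closure r σ hg] at hU'
  exact hU'

/-! ## The level of a connected tempered covering -/

/-- A point of a tempered `Grp r σ`-set is fixed by some `Δ_n`. [cite: MochizukiEtTh2009, Def 3.3 (ii) p.73] -/
theorem exists_closure_fix (T : BTemp (Grp r σ)) (y : T.obj.V) : ∃ n, ∀ g ∈ closure r σ n, T.obj.ρ g y = y := by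
  obtain ⟨n, hn⟩ := exists_closure_subset_of_isOpen r σ (T.property.2 y) (BTempConnected.ρ_one_apply T y)
  exact ⟨n, fun g hg => hn hg⟩

/-- For a CONNECTED tempered covering one `Δ_n` fixes every point (one orbit, conjugate stabilisers, normality).
[cite: MochizukiEtTh2009, Def 3.3 (ii) p.73] -/
theorem exists_closure_fixes (Y : ConnectedPart (BTemp (Grp r σ))) :
    ∃ n, ∀ g ∈ closure r σ n, ∀ y : Y.obj.obj.V, Y.obj.obj.ρ g y = y := by
  obtain ⟨y₀⟩ := BTempConnected.nonempty_of_isConnectedObj Y.obj Y.property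
  obtain ⟨n, hn⟩ := exists_closure_fix r σ Y.obj y₀
  refine ⟨n, fun g hg y => ?_⟩
  obtain ⟨h, rfl⟩ := BTempConnected.exists_ρ_eq_of_isConnectedObj Y.obj Y.property y₀ y
  have hc : h⁻¹ * g * h⁻¹⁻¹ ∈ closure r σ n := (closure_normal r σ n).conj_mem g hg h⁻¹
  rw [inv_inv] at hc
  rw [← BTempConnected.ρ_mul_apply, show g * h = h * (h⁻¹ * g * h) by
      rw [← mul_assoc, ← mul_assoc, mul_inv_cancel, one_mul],
    BTempConnected.ρ_mul_apply, hn _ hc]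

/-- **The level of a connected tempered covering `Y`**: the least `n` such that `Δ_n` fixes `Y`. [cite: MochizukiEtTh2009, Def 3.3 (ii) p.73] -/
def lvl (Y : ConnectedPart (BTemp (Grp r σ))) : ℕ := sInf {n | ∀ g ∈ closure r σ n, ∀ y : Y.obj.obj.V, Y.obj.obj.ρ g y = y}

/-- `Δ_{lvl Y}` fixes `Y`. [cite: MochizukiEtTh2009, Def 3.3 (i) p.72] -/
theorem closure_lvl_fixes (Y : ConnectedPart (BTemp (Grp r σ))) :
    ∀ g ∈ closure r σ (lvl r σ Y), ∀ y : Y.obj.obj.V, Y.obj.obj.ρ g y = y :=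
  Nat.sInf_mem (s := {n | ∀ g ∈ closure r σ n, ∀ y : Y.obj.obj.V, Y.obj.obj.ρ g y = y}) (exists_closure_fixes r σ Y)

/-- Minimality of the level. [cite: MochizukiEtTh2009, Def 3.3 (i) p.72] -/
theorem lvl_le {Y : ConnectedPart (BTemp (Grp r σ))} {n : ℕ} (h : ∀ g ∈ closure r σ n, ∀ y : Y.obj.obj.V, Y.obj.obj.ρ g y = y) :
    lvl r σ Y ≤ n :=
  Nat.sInf_le h

/-- Levels are monotone along covering maps. [cite: MochizukiEtTh2009, Def 3.3 (i) p.72] -/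
theorem lvl_le_of_hom {Y Y' : ConnectedPart (BTemp (Grp r σ))} (f : Y' ⟶ Y) : lvl r σ Y ≤ lvl r σ Y' := by
  obtain ⟨y'₀⟩ := BTempConnected.nonempty_of_isConnectedObj Y'.obj Y'.property
  refine lvl_le r σ fun g hg y => ?_
  obtain ⟨y', rfl⟩ := BTempConnected.surjective_of_isConnectedObj y'₀ Y.property f.hom y
  rw [← BTempConnected.hom_ρ, closure_lvl_fixes r σ Y' g hg y']

/-- **The level structure of the shear-semidirect ζ-twisted Kummer–Tate group** (Def. 3.3 (i)(c)/(ii)): levels `ℕ`, normal `Δ_n`,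
`lvl`; BOTH laws PROVED. [cite: MochizukiEtTh2009, Def 3.3 (i) p.72] -/
def levels : LevelSystem (Grp r σ) where
  I := ℕ
  closure := closure r σ
  closure_normal := closure_normal r σ
  lvl := lvl r σ
  closure_lvl_act Y g hg y := closure_lvl_fixes r σ Y g hg y
  closure_lvl_mono f := closure_antitone r σ (lvl_le_of_hom r σ f)

/-- The levels of `levels r σ` are linearly ordered by their closures (`r ≠ 0`). [cite: MochizukiEtTh2009, Def 3.3 (ii) p.73] -/
theorem levels_le_of_closure_le [NeZero r] {i j : ℕ} (h : (levels r σ).closure j ≤ (levels r σ).closure i) : i ≤ j :=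
  le_of_closure_le r σ h

/-- The ζ-TWIST survives: conjugation by a constant-field element `(1, (c, 1))` on the generator `δ_{n,j}` multiplies the index-`n`
classes by `χ_n(c)`. [cite: MochizukiEtTh2009, §1 p.13] -/
theorem conj_const_delta_coord (c : Cst) (n : ℕ) (j : Fin r) :
    ((SemidirectProduct.inr (c, (1 : Multiplicative ℤ)) : Grp r σ) * delta r σ n j *
        (SemidirectProduct.inr (c, (1 : Multiplicative ℤ)))⁻¹).left.toAdd n =
      Pi.single j (c n : ZMod (M n)) := by
  rw [delta, conj_ofKum, ofKum, SemidirectProduct.left_inl, SemidirectProduct.right_inr, toAdd_act_const_apply,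
    toAdd_ofAdd, Pi.single_eq_same, ← Pi.single_smul, smul_eq_mul, mul_one]

/-! ## `r = 3`: the theta shear of the `Ÿ`-tower (transpose of L2-t3's `shear (−a)`), and `r = 2`: the chain shear -/

/-- The matrix `σ_a = (S_{−a})ᵀ = [[1, 0, 0], [a, 1, 0], [−a², −2a, 1]]` by which the translation `a` conjugates the Kummer
classes `(κ_ϖ, κ_U, κ_Θ)` of the roots of `ϖ̈`, `Ü`, `Θ̈`. [cite: MochizukiEtTh2009, Prop 1.4 p.22] -/
def thetaShearMat (a : ℤ) : Matrix (Fin 3) (Fin 3) ℤ := !![1, 0, 0; a, 1, 0; -(a * a), -(2 * a), 1]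

/-- `σ_0 = 1`. [cite: MochizukiEtTh2009, Prop 1.4 p.22] -/
theorem thetaShearMat_zero : thetaShearMat 0 = 1 := by
  ext i j
  fin_cases i <;> fin_cases j <;> simp [thetaShearMat]

/-- `σ_a σ_b = σ_{a+b}` (the shears commute and compose additively). [cite: MochizukiEtTh2009, Prop 1.4 p.22] -/
theorem thetaShearMat_add (a b : ℤ) : thetaShearMat (a + b) = thetaShearMat a * thetaShearMat b := by
  ext i j
  fin_cases i <;> fin_cases j <;> simp [thetaShearMat, Matrix.mul_apply, Fin.sum_univ_three] <;> ring

/-- **The theta shear as a representation of the translations** `ℤ_γ → GL₃(ℤ)` (as a monoid hom into `3 × 3` integer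
matrices). [cite: MochizukiEtTh2009, Prop 1.4 p.22] -/
def thetaShear : Multiplicative ℤ →* Matrix (Fin 3) (Fin 3) ℤ where
  toFun a := thetaShearMat (Multiplicative.toAdd a)
  map_one' := by rw [toAdd_one, thetaShearMat_zero]
  map_mul' a b := by rw [toAdd_mul, thetaShearMat_add]

/-- `thetaShear` evaluated. [cite: MochizukiEtTh2009, Prop 1.4 p.22] -/
@[simp] theorem thetaShear_apply (a : Multiplicative ℤ) : thetaShear a = thetaShearMat (Multiplicative.toAdd a) := rfl

/-- `σ_a κ` in coordinates: `(κ_ϖ, a κ_ϖ + κ_U, −a² κ_ϖ − 2a κ_U + κ_Θ)`. [cite: MochizukiEtTh2009, Prop 1.4 p.22] -/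
theorem thetaShearMat_mulVec (a : ℤ) (κ : Fin 3 → ℤ) :
    Matrix.mulVec (thetaShearMat a) κ = ![κ 0, a * κ 0 + κ 1, -(a * a) * κ 0 - 2 * a * κ 1 + κ 2] := by
  ext i
  fin_cases i <;> simp [thetaShearMat, Matrix.mulVec, dotProduct, Fin.sum_univ_three]
  ring

/-- **ADEQUACY of `σ` to abc-iut-L2-t3's translation shear on the functions of `Ÿ`** (p477445 `LogDivisorModel.TateTowerTheta.shear`):
for every class triple `κ` and every exponent vector `f`, `(σ_a κ) · (eC f, eU f, eT f) = κ · (eC, eU, eT)(shear (−a) f)` — the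
exponent of `ζ_m` in `T_a K_κ T_a⁻¹ (f) = K_{κ S_{−a}} (f)`; so over `Grp 3 thetaShear` the three Kummer classes can act on
`ϖ̈_m`, `Ü_m`, `Θ̈_m`-roots JOINTLY with the translations (no class is forced trivial). [cite: MochizukiEtTh2009, Prop 1.4 p.22] -/
theorem thetaShear_pairing_shear (a : ℤ) (κ : Fin 3 → ℤ) (f : LogDivisorModel.TateTowerTheta.Exp) :
    Matrix.mulVec (thetaShearMat a) κ 0 * LogDivisorModel.TateTowerTheta.eC f +
        Matrix.mulVec (thetaShearMat a) κ 1 * LogDivisorModel.TateTowerTheta.eU f +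
        Matrix.mulVec (thetaShearMat a) κ 2 * LogDivisorModel.TateTowerTheta.eT f =
      κ 0 * LogDivisorModel.TateTowerTheta.eC (LogDivisorModel.TateTowerTheta.shear (-a) f) +
        κ 1 * LogDivisorModel.TateTowerTheta.eU (LogDivisorModel.TateTowerTheta.shear (-a) f) +
        κ 2 * LogDivisorModel.TateTowerTheta.eT (LogDivisorModel.TateTowerTheta.shear (-a) f) := by
  simp only [thetaShearMat_mulVec, Matrix.cons_val_zero, Matrix.cons_val_one, Matrix.cons_val_two, Matrix.head_cons,
    Matrix.tail_cons, LogDivisorModel.TateTowerTheta.eC_shear, LogDivisorModel.TateTowerTheta.eU_shear,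
    LogDivisorModel.TateTowerTheta.eT_shear]
  ring

/-- The obstruction in the DIRECT product, made precise: the pairing `κ · e` is invariant under ALL shears `e ↦ S_a e` of all
exponent vectors iff `κ_ϖ = 0 ∧ 2 κ_U = 0` (over `ℤ`; test vectors the roots of `Ü` and of `Θ̈`, `a = 1`) — so in
`(K_3 ⋊_χ C) × ℤ_γ` only the `Θ̈`-class (and a sign's worth of the `Ü`-class) can act equivariantly.
[cite: MochizukiEtTh2009, Prop 1.4 p.22] -/
theorem pairing_shear_invariant_iff (κ : Fin 3 → ℤ) :
    (∀ (a : ℤ) (f : LogDivisorModel.TateTowerTheta.Exp),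
      κ 0 * LogDivisorModel.TateTowerTheta.eC (LogDivisorModel.TateTowerTheta.shear a f) +
          κ 1 * LogDivisorModel.TateTowerTheta.eU (LogDivisorModel.TateTowerTheta.shear a f) +
          κ 2 * LogDivisorModel.TateTowerTheta.eT (LogDivisorModel.TateTowerTheta.shear a f) =
        κ 0 * LogDivisorModel.TateTowerTheta.eC f + κ 1 * LogDivisorModel.TateTowerTheta.eU f +
          κ 2 * LogDivisorModel.TateTowerTheta.eT f) ↔ κ 0 = 0 ∧ 2 * κ 1 = 0 := by
  constructor
  · intro h
    -- test vectors: the root of `Ü` (`(c,k,t) = (0,1,0)`) and of `Θ̈` (`(0,0,1)`), translation `a = 1`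
    have hU := h 1 ((0 : ZMod 2), (0 : ℤ), (1 : ℤ), (0 : ℤ))
    have hT := h 1 ((0 : ZMod 2), (0 : ℤ), (0 : ℤ), (1 : ℤ))
    simp only [LogDivisorModel.TateTowerTheta.eC_shear, LogDivisorModel.TateTowerTheta.eU_shear,
      LogDivisorModel.TateTowerTheta.eT_shear] at hU hT
    simp only [LogDivisorModel.TateTowerTheta.eC, LogDivisorModel.TateTowerTheta.eU, LogDivisorModel.TateTowerTheta.eT] at hU hT
    constructor <;> linarith
  · rintro ⟨h0, h1⟩ a f
    simp only [LogDivisorModel.TateTowerTheta.eC_shear, LogDivisorModel.TateTowerTheta.eU_shear,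
      LogDivisorModel.TateTowerTheta.eT_shear, h0, zero_mul, zero_add]
    linear_combination (a * LogDivisorModel.TateTowerTheta.eT f) * h1

/-- **«GRP₃′»** — the shear-semidirect group of TATE TOWER v3: three Kummer classes per level (roots of `ϖ̈`, `Ü`, `Θ̈`), the
translations acting on them through the theta shear. [cite: MochizukiEtTh2009, Def 3.3 (ii) p.73] -/
abbrev Grp₃' : Type := Grp 3 thetaShear

/-- The level structure of «GRP₃′», levels pairwise distinct. [cite: MochizukiEtTh2009, Def 3.3 (i) p.72] -/
theorem levels_three_le_of_closure_le {i j : ℕ} (h : (levels 3 thetaShear).closure j ≤ (levels 3 thetaShear).closure i) :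
    i ≤ j :=
  levels_le_of_closure_le 3 thetaShear h

/-- The chain shear `[[1, 0], [a, 1]]` (`r = 2`: classes of the roots of `ϖ`, `U`; translation `U ↦ ϖ^{−a} U` on the chain-only
skeleton): with it the `ϖ`-root class is twistable too. [cite: MochizukiEtTh2009, Def 3.3 (ii) p.73] -/
def chainShearMat (a : ℤ) : Matrix (Fin 2) (Fin 2) ℤ := !![1, 0; a, 1]

/-- `chainShearMat 0 = 1`. [cite: MochizukiEtTh2009, Def 3.3 (ii) p.73] -/
theorem chainShearMat_zero : chainShearMat 0 = 1 := by
  ext i j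
  fin_cases i <;> fin_cases j <;> simp [chainShearMat]

/-- `chainShearMat (a + b) = chainShearMat a * chainShearMat b`. [cite: MochizukiEtTh2009, Def 3.3 (ii) p.73] -/
theorem chainShearMat_add (a b : ℤ) : chainShearMat (a + b) = chainShearMat a * chainShearMat b := by
  ext i j
  fin_cases i <;> fin_cases j <;> simp [chainShearMat, Matrix.mul_apply, Fin.sum_univ_two]

/-- The chain shear as a representation of the translations. [cite: MochizukiEtTh2009, Def 3.3 (ii) p.73] -/
def chainShear : Multiplicative ℤ →* Matrix (Fin 2) (Fin 2) ℤ where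
  toFun a := chainShearMat (Multiplicative.toAdd a)
  map_one' := by rw [toAdd_one, chainShearMat_zero]
  map_mul' a b := by rw [toAdd_mul, chainShearMat_add]

/-- **«GRP₂′»** — the shear-semidirect group of the chain-only tower (both the `ϖ`- and the `U`-root classes twistable).
[cite: MochizukiEtTh2009, Def 3.3 (ii) p.73] -/
abbrev Grp₂' : Type := Grp 2 chainShear

end TateTowerKummerTwistRShear

end Literature.AnabelianGeometry.EtaleTheta

end
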